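import Mathlib
import Literature.Analysis.FluidPDE.NSGaldiExtendedTest
import Literature.Analysis.FluidPDE.WeakGradientIBP
import Summits.NavierStokesRegularity.NavierStokesRegularity.Theorems.EulerZoomLiouvillePowerGaugeEulerLiouvilleGalileanTensorTest
import HarnessLib

/-!
# Crux `EulerZoomLiouville.PowerGaugeEulerLiouville` (stmt-NavierStokesRegularity-19832), stub `stub_nonSelfSimilarRest`:
# the EULER BRACKETS OF A SEPARABLE FIELD `v(τ, x) = θ(τ) U(x)` — tools

Helper file (theorems only; `--supports stmt-NavierStokesRegularity-19832`; def-free).  Hand leafhand-ns-eulerzoomliouville-11 g0.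
The E-gauge and A-gauge files of this hand (`…SeparablePast`, `…ModulatedPatternPast`, …) leave exactly the separable pasts with EVANESCENT
modulation; these need the Euler identity itself.  Here: for a distributional Euler pair `(v, p)` on `(−∞,0) × ℝ³` whose slices are
LITERALLY `v(τ) = θ(τ) U` for `τ < T₁ ≤ 0` (`θ` continuous, `U ∈ L¹_loc ∩ L²_loc`), the momentum identity tested with `χ(τ)Φ(x)`
(`Φ` a divergence-free test field, `χ ∈ C_c^∞((−∞,T₁))`; tree `GalileanFrames.integral_tensorTest`) and the divergence identity tested
with `χ(τ)g(x)` (tree `GalileanFrames.integral_scalarTensorTest`) read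
`(∫χ'θ) A(Φ) + (∫χθ²) N(Φ) = 0`, `(∫χθ) D(g) = 0`, with `A(Φ) = ∫⟪U,Φ⟫`, `N(Φ) = ∫⟪U, DΦ·U⟫`, `D(g) = ∫⟪U,∇g⟫`
(`SeparableEuler.brackets_momentum`, `SeparableEuler.brackets_div`); for `θ ∈ C¹` the fundamental lemma
(tree `GalileanFrames.eq_of_integral_deriv_mul_add_eq_zero_Iio`) turns them into `θ(t)² N(Φ) = θ'(t) A(Φ)` and `θ(t) D(g) = 0` for every
`t < T₁`; hence, UNLESS `θ` SOLVES THE COLLAPSE ODE `θ' = λθ²` on `(−∞,T₁)` for some constant `λ` (solutions: `θ ≡ 0`, `θ ≡ const`,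
`θ = 1/(λ(T−τ))` — the `γ = 0` self-similar collapse), `U` is weakly orthogonal to every divergence-free test field (in particular weakly
curl-free) and weakly divergence-free (`SeparableEuler.integral_inner_eq_zero_of_not_ode`, `SeparableEuler.isWeaklyDivFree_of_not_ode`).

WHAT THIS IS NOT: not a proof of the stub or of the crux; nothing about Navier–Stokes. [folklore; CaffarelliKohnNirenberg1982 §2 (2.1)–(2.2)]
-/

noncomputable section

-- flat `Theorems/<Route><Decl>…` files of one crux share the namespace of the crux (tree convention)
set_option linter.dupNamespace false

open MeasureTheory Set Filter Topology Metric Function TopologicalSpace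
open scoped RealInnerProductSpace NNReal ENNReal ContDiff

namespace Summit.NavierStokesRegularity.NavierStokesRegularity.Theorems.PowerGaugeEulerLiouville

open Literature.Analysis Literature.Analysis.FunctionSpaces Literature.Analysis.FluidPDE

namespace SeparableEuler

variable {v : ℝ → EuclideanSpace ℝ (Fin 3) → EuclideanSpace ℝ (Fin 3)} {p : ℝ → EuclideanSpace ℝ (Fin 3) → ℝ}
  {θ : ℝ → ℝ} {U : EuclideanSpace ℝ (Fin 3) → EuclideanSpace ℝ (Fin 3)} {T₁ : ℝ}

/-! ## 1. The brackets -/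

/-- **MOMENTUM BRACKET OF A SEPARABLE FIELD.**  For a distributional Euler pair `(v, p)` on `(−∞,0) × ℝ³` with `v(τ) = θ(τ) U` for all
`τ < T₁ ≤ 0` (`U ∈ L¹_loc`, `|U|² ∈ L¹_loc`), every divergence-free test field `Φ` and every `χ ∈ C_c^∞((−∞,T₁))`:
`(∫ χ'θ) ∫⟪U,Φ⟫ + (∫ χθ²) ∫⟪U, DΦ·U⟫ = 0`. [cite: CaffarelliKohnNirenberg1982, §2 (2.1)–(2.2)] -/
theorem brackets_momentum
    (hsol : IsDistributionalNSSolutionOn (slab (EuclideanSpace ℝ (Fin 3)) (Iio 0) isOpen_Iio) 0 0 v p)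
    (hT₁ : T₁ ≤ 0) (hv : ∀ τ, τ < T₁ → v τ = fun x => θ τ • U x) (hθc : Continuous θ)
    (hU : LocallyIntegrable U volume) (hU2 : LocallyIntegrable (fun y => ‖U y‖ ^ 2) volume)
    {Φ : EuclideanSpace ℝ (Fin 3) → EuclideanSpace ℝ (Fin 3)} (hΦ : IsTestFunctionOn (⊤ : Opens (EuclideanSpace ℝ (Fin 3))) Φ)
    (hdiv : ∀ z, VectorCalculus.divergence Φ z = 0)
    {χ : ℝ → ℝ} (hχ : ContDiff ℝ (⊤ : ℕ∞) χ) (hχc : HasCompactSupport χ) (hχT : tsupport χ ⊆ Iio T₁) :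
    (∫ τ, deriv χ τ * θ τ) * (∫ y, ⟪U y, Φ y⟫) + (∫ τ, χ τ * θ τ ^ 2) * (∫ y, ⟪U y, (fderiv ℝ Φ y) (U y)⟫) = 0 := by
  have hDΦc : Continuous (fderiv ℝ Φ) := hΦ.contDiff.continuous_fderiv (by simp)
  have hDΦs : HasCompactSupport (fderiv ℝ Φ) := hΦ.hasCompactSupport.fderiv (𝕜 := ℝ)
  have hχ0 : tsupport χ ⊆ Iio 0 := hχT.trans (Iio_subset_Iio hT₁)
  have hΦc : Continuous Φ := hΦ.contDiff.continuous
  -- slice pairings on the support of `χ`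
  have hint₁ : ∀ τ ∈ tsupport χ, Integrable (fun y => ⟪v τ y, Φ y⟫) volume := by
    intro τ hτ
    rw [hv τ (hχT hτ)]
    have h := (integrable_inner_of_locallyIntegrable_of_hasCompactSupport hU hΦc hΦ.hasCompactSupport).const_mul (θ τ)
    refine h.congr (Eventually.of_forall fun y => ?_)
    simp only [real_inner_smul_left]
  have hint₂ : ∀ τ ∈ tsupport χ, Integrable (fun y => ⟪v τ y, (fderiv ℝ Φ y) (v τ y)⟫) volume := by
    intro τ hτ
    rw [hv τ (hχT hτ)]
    have h0 := GalileanFrames.integrable_inner_clm_comp_add_self hU.aestronglyMeasurable hU2 hDΦc hDΦs 0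
    have h0' : Integrable (fun y => ⟪U y, (fderiv ℝ Φ y) (U y)⟫) volume :=
      h0.congr (Eventually.of_forall fun y => by simp only [add_zero])
    have h := h0'.const_mul (θ τ * θ τ)
    refine h.congr (Eventually.of_forall fun y => ?_)
    simp only [map_smul, real_inner_smul_left, real_inner_smul_right]
    ring
  have h0 := GalileanFrames.integral_tensorTest hsol hΦ hdiv hχ hχc hχ0 hint₁ hint₂
  -- the integrand, slice by slice
  have hχ0' : ∀ t, t ∉ tsupport χ → χ t = 0 := fun t ht => image_eq_zero_of_notMem_tsupport ht
  have hχ'0' : ∀ t, t ∉ tsupport χ → deriv χ t = 0 := fun t ht => by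
    by_contra hne; exact ht (tsupport_deriv_subset (subset_tsupport _ (mem_support.2 hne)))
  have hpt : ∀ τ, deriv χ τ * (∫ y, ⟪v τ y, Φ y⟫) + χ τ * ∫ y, ⟪v τ y, (fderiv ℝ Φ y) (v τ y)⟫ =
      (deriv χ τ * θ τ) * (∫ y, ⟪U y, Φ y⟫) + (χ τ * θ τ ^ 2) * ∫ y, ⟪U y, (fderiv ℝ Φ y) (U y)⟫ := by
    intro τ
    by_cases hτ : τ ∈ tsupport χ
    · rw [hv τ (hχT hτ)]
      have e1 : ∫ y, ⟪θ τ • U y, Φ y⟫ = θ τ * ∫ y, ⟪U y, Φ y⟫ := by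
        rw [← integral_const_mul]
        exact integral_congr_ae (Eventually.of_forall fun y => by simp only [real_inner_smul_left])
      have e2 : ∫ y, ⟪θ τ • U y, (fderiv ℝ Φ y) (θ τ • U y)⟫ = θ τ ^ 2 * ∫ y, ⟪U y, (fderiv ℝ Φ y) (U y)⟫ := by
        rw [← integral_const_mul]
        exact integral_congr_ae (Eventually.of_forall fun y => by
          simp only [map_smul, real_inner_smul_left, real_inner_smul_right]; ring)
      simp only [e1, e2]
      ring
    · rw [hχ0' τ hτ, hχ'0' τ hτ]
      ring
  simp_rw [hpt] at h0
  have hi1 : Integrable (fun τ => deriv χ τ * θ τ) volume :=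
    ((hχ.continuous_deriv (by simp)).mul hθc).integrable_of_hasCompactSupport hχc.deriv.mul_right
  have hi2 : Integrable (fun τ => χ τ * θ τ ^ 2) volume :=
    (hχ.continuous.mul (hθc.pow 2)).integrable_of_hasCompactSupport hχc.mul_right
  rw [integral_add (hi1.mul_const _) (hi2.mul_const _), integral_mul_const, integral_mul_const] at h0
  exact h0

/-- **DIVERGENCE BRACKET OF A SEPARABLE FIELD**: `(∫ χθ) ∫⟪U, ∇g⟫ = 0` for every scalar test function `g` and every
`χ ∈ C_c^∞((−∞,T₁))`. [cite: CaffarelliKohnNirenberg1982, §2 (2.1)] -/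
theorem brackets_div
    (hsol : IsDistributionalNSSolutionOn (slab (EuclideanSpace ℝ (Fin 3)) (Iio 0) isOpen_Iio) 0 0 v p)
    (hT₁ : T₁ ≤ 0) (hv : ∀ τ, τ < T₁ → v τ = fun x => θ τ • U x)
    {g : EuclideanSpace ℝ (Fin 3) → ℝ} (hg : IsTestFunctionOn (⊤ : Opens (EuclideanSpace ℝ (Fin 3))) g)
    {χ : ℝ → ℝ} (hχ : ContDiff ℝ (⊤ : ℕ∞) χ) (hχc : HasCompactSupport χ) (hχT : tsupport χ ⊆ Iio T₁) :
    (∫ τ, χ τ * θ τ) * (∫ y, ⟪U y, gradient g y⟫) = 0 := by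
  have hχ0 : tsupport χ ⊆ Iio 0 := hχT.trans (Iio_subset_Iio hT₁)
  have h0 := GalileanFrames.integral_scalarTensorTest hsol hg hχ hχc hχ0
  have hχ0' : ∀ t, t ∉ tsupport χ → χ t = 0 := fun t ht => image_eq_zero_of_notMem_tsupport ht
  have hpt : ∀ τ, χ τ * (∫ y, ⟪v τ y, gradient g y⟫) = (χ τ * θ τ) * ∫ y, ⟪U y, gradient g y⟫ := by
    intro τ
    by_cases hτ : τ ∈ tsupport χ
    · rw [hv τ (hχT hτ)]
      have e1 : ∫ y, ⟪θ τ • U y, gradient g y⟫ = θ τ * ∫ y, ⟪U y, gradient g y⟫ := by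
        rw [← integral_const_mul]
        exact integral_congr_ae (Eventually.of_forall fun y => by simp only [real_inner_smul_left])
      rw [e1]
      ring
    · rw [hχ0' τ hτ]
      ring
  simp_rw [hpt] at h0
  rwa [integral_mul_const] at h0

/-! ## 2. Consequences for `θ ∈ C¹`: the collapse ODE or annihilation -/

/-- Pointwise form of the momentum bracket for `θ ∈ C¹`: `θ(t)² N(Φ) = θ'(t) A(Φ)` for every `t < T₁`. [folklore] -/
theorem sq_mul_eq_deriv_mul
    (hsol : IsDistributionalNSSolutionOn (slab (EuclideanSpace ℝ (Fin 3)) (Iio 0) isOpen_Iio) 0 0 v p)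
    (hT₁ : T₁ ≤ 0) (hv : ∀ τ, τ < T₁ → v τ = fun x => θ τ • U x) (hθ1 : ContDiff ℝ 1 θ)
    (hU : LocallyIntegrable U volume) (hU2 : LocallyIntegrable (fun y => ‖U y‖ ^ 2) volume)
    {Φ : EuclideanSpace ℝ (Fin 3) → EuclideanSpace ℝ (Fin 3)} (hΦ : IsTestFunctionOn (⊤ : Opens (EuclideanSpace ℝ (Fin 3))) Φ)
    (hdiv : ∀ z, VectorCalculus.divergence Φ z = 0) {t : ℝ} (ht : t < T₁) :
    θ t ^ 2 * (∫ y, ⟪U y, (fderiv ℝ Φ y) (U y)⟫) = deriv θ t * ∫ y, ⟪U y, Φ y⟫ := by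
  have hθc : Continuous θ := hθ1.continuous
  have hθ'c : Continuous (deriv θ) := hθ1.continuous_deriv le_rfl
  set A : ℝ := ∫ y, ⟪U y, Φ y⟫ with hA
  set N : ℝ := ∫ y, ⟪U y, (fderiv ℝ Φ y) (U y)⟫ with hN
  refine GalileanFrames.eq_of_integral_deriv_mul_add_eq_zero_Iio (f := fun τ => θ τ * A) (g := fun τ => deriv θ τ * A)
    (N := fun τ => θ τ ^ 2 * N) (fun τ _ => ((hθ1.differentiable (by norm_num)) τ).hasDerivAt.mul_const A)
    ((hθ'c.mul continuous_const).continuousOn) (((hθc.pow 2).mul continuous_const).continuousOn) ?_ ht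
  intro χ hχ hχc hχT
  have hi1 : Integrable (fun τ => deriv χ τ * θ τ) volume :=
    ((hχ.continuous_deriv (by simp)).mul hθc).integrable_of_hasCompactSupport hχc.deriv.mul_right
  have hi2 : Integrable (fun τ => χ τ * θ τ ^ 2) volume :=
    (hχ.continuous.mul (hθc.pow 2)).integrable_of_hasCompactSupport hχc.mul_right
  have h := brackets_momentum hsol hT₁ hv hθc hU hU2 hΦ hdiv hχ hχc hχT
  simp_rw [← mul_assoc]
  rw [integral_add (hi1.mul_const _) (hi2.mul_const _), integral_mul_const, integral_mul_const]
  exact h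

/-- **ANNIHILATION UNLESS THE COLLAPSE ODE HOLDS.**  If `θ ∈ C¹` does NOT satisfy `θ' = λ θ²` on `(−∞,T₁)` for any constant `λ`,
then `∫⟪U, Φ⟫ = 0` for every divergence-free test field `Φ` (`U` is weakly a gradient; in particular weakly curl-free). [folklore] -/
theorem integral_inner_eq_zero_of_not_ode
    (hsol : IsDistributionalNSSolutionOn (slab (EuclideanSpace ℝ (Fin 3)) (Iio 0) isOpen_Iio) 0 0 v p)
    (hT₁ : T₁ ≤ 0) (hv : ∀ τ, τ < T₁ → v τ = fun x => θ τ • U x) (hθ1 : ContDiff ℝ 1 θ)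
    (hode : ¬ ∃ l : ℝ, ∀ t, t < T₁ → deriv θ t = l * θ t ^ 2)
    (hU : LocallyIntegrable U volume) (hU2 : LocallyIntegrable (fun y => ‖U y‖ ^ 2) volume)
    {Φ : EuclideanSpace ℝ (Fin 3) → EuclideanSpace ℝ (Fin 3)} (hΦ : IsTestFunctionOn (⊤ : Opens (EuclideanSpace ℝ (Fin 3))) Φ)
    (hdiv : ∀ z, VectorCalculus.divergence Φ z = 0) :
    ∫ y, ⟪U y, Φ y⟫ = 0 := by
  by_contra hA
  apply hode
  refine ⟨(∫ y, ⟪U y, (fderiv ℝ Φ y) (U y)⟫) / ∫ y, ⟪U y, Φ y⟫, fun t ht => ?_⟩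
  have h := sq_mul_eq_deriv_mul hsol hT₁ hv hθ1 hU hU2 hΦ hdiv ht
  rw [div_mul_eq_mul_div, eq_div_iff hA]
  linarith [h]

/-- **WEAK INCOMPRESSIBILITY OF THE PATTERN UNLESS THE COLLAPSE ODE HOLDS**: under the same hypothesis `U` is weakly divergence
free (the ODE with `λ = 0` is excluded, so `θ ≢ 0` on `(−∞,T₁)`). [folklore] -/
theorem isWeaklyDivFree_of_not_ode
    (hsol : IsDistributionalNSSolutionOn (slab (EuclideanSpace ℝ (Fin 3)) (Iio 0) isOpen_Iio) 0 0 v p)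
    (hT₁ : T₁ ≤ 0) (hv : ∀ τ, τ < T₁ → v τ = fun x => θ τ • U x) (hθ1 : ContDiff ℝ 1 θ)
    (hode : ¬ ∃ l : ℝ, ∀ t, t < T₁ → deriv θ t = l * θ t ^ 2) :
    IsWeaklyDivFree U := by
  have hθc : Continuous θ := hθ1.continuous
  intro g hg
  set D : ℝ := ∫ y, ⟪U y, gradient g y⟫ with hD
  -- `θ(t) D = 0` for every `t < T₁`
  have hpt : ∀ t, t < T₁ → θ t * D = 0 := by
    intro t ht
    have h := GalileanFrames.eq_of_integral_deriv_mul_add_eq_zero_Iio (f := fun _ => (0 : ℝ)) (g := fun _ => (0 : ℝ))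
      (N := fun τ => θ τ * D) (fun τ _ => hasDerivAt_const τ (0 : ℝ)) continuousOn_const
      ((hθc.mul continuous_const).continuousOn) ?_ ht
    · simpa using h
    · intro χ hχ hχc hχT
      have e : (fun τ => deriv χ τ * (0 : ℝ) + χ τ * (θ τ * D)) = fun τ => (χ τ * θ τ) * D := by
        funext τ; ring
      rw [e, integral_mul_const]
      exact brackets_div hsol hT₁ hv hg hχ hχc hχT
  by_contra hDne
  apply hode
  refine ⟨0, fun t ht => ?_⟩
  have hz : ∀ s, s < T₁ → θ s = 0 := fun s hs => (mul_eq_zero.1 (hpt s hs)).resolve_right hDne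
  have hev : θ =ᶠ[𝓝 t] fun _ => (0 : ℝ) := by
    filter_upwards [Iio_mem_nhds ht] with s hs
    exact hz s hs
  rw [hev.deriv_eq, deriv_const]
  ring

end SeparableEuler

end Summit.NavierStokesRegularity.NavierStokesRegularity.Theorems.PowerGaugeEulerLiouville

end
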